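import Summits.NavierStokesRegularity.NavierStokesRegularity.Theses.FrozenSignCascade

/-!
# Route FrozenSignCascade — `Assembly` (item stmt-NavierStokesRegularity-10581)

Pure logic: the two hypotheses of the route's deciding theorem, in the antecedent order

  `EnvelopeBound → BoundedEnvelopeContinuation → NavierStokesRegularity`,

imply Clay (A). This is, hypothesis for hypothesis, the route's deciding theorem
`Summit.NavierStokesRegularity.NavierStokesRegularity.Theses.FrozenSignCascade.closes`; the proof
below is self-contained (it does not invoke `closes`), so that it depends only on the item
definitions.

Argument. Fix `ν > 0` and a Clay datum `u₀` (smooth, divergence-free, rapidly decaying).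
`EnvelopeBound` (A) supplies, at every horizon `T₀ > 0`, a constant `C` bounding the critical
Fourier envelope `‖ξ‖² ‖V t ξ‖` of every Fourier-mild solution `V` from `𝓕⁻u₀` on `[0,T]`, `T ≤ T₀`;
this is literally the hypothesis of `BoundedEnvelopeContinuation` (B) for `(ν, u₀)`, whose
conclusion is the Clay (A) conclusion `∃ u p, IsSmoothOnHalfSpace u ∧ IsSmoothOnHalfSpace p ∧
IsNavierStokesSolution ν 0 u₀ u p ∧ HasBoundedEnergy u` for that datum. Nothing here is new
mathematics; the open content lives in the cruxes A and B.
-/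

namespace Summit.NavierStokesRegularity.NavierStokesRegularity.Theorems

open Summit.NavierStokesRegularity.NavierStokesRegularity.Theses.FrozenSignCascade

/-- **Assembly** (item stmt-NavierStokesRegularity-10581, route FrozenSignCascade):
`EnvelopeBound → BoundedEnvelopeContinuation → NavierStokesRegularity` — pure logic: for each
`ν > 0` and Clay datum `u₀`, `EnvelopeBound` gives the critical-envelope bound at every horizon,
which is exactly the hypothesis of `BoundedEnvelopeContinuation`, whose conclusion is the Clay (A)
conclusion for `u₀`. [folklore] -/
theorem frozenSignCascade_assembly_proof :
    Summit.NavierStokesRegularity.NavierStokesRegularity.Theses.FrozenSignCascade.Assembly := by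
  unfold Assembly
  intro hA hB ν hν u₀ hu hdiv hd
  exact hB ν hν u₀ hu hd hdiv (hA ν hν u₀ hu hd hdiv)

end Summit.NavierStokesRegularity.NavierStokesRegularity.Theorems
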